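import Summits.NavierStokesRegularity.NavierStokesRegularity.Theorems.RecurrentProfilesRecurrentReductionOrbit
import Literature.Analysis.FluidPDE.ScalingRecurrentSlabField
import HarnessLib

/-!
# Crux `RecurrentLiouville` (stmt-NavierStokesRegularity-1589), line `Sketch` — stub `stub_satDecayedReduction` (S3)

`stub_satDecayedReduction` — RECURRENCE IS NOT LOAD-BEARING IN THE APEX CLASS: if a suitable weak
solution `(u, p)` of Navier–Stokes (`ν = 1`, `f = 0`) on the backward slab `ℝ³ × ℝ₋` with weak
gradient `G`, Albritton–Barker quantity `𝐈(ℝ³ × ℝ₋) < ∞` and the APEX (space–time Type-I) bound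
`‖u(t, x)‖ ≤ C/(‖x‖ + √(−t))` (KNSS 2009, (1.6)) has a backward-singular origin, then some
profile of the same class — same `C` — is singular at the origin AND uniformly recurrent under the
Navier–Stokes scaling `σ ↦ u_{e^σ}` in `L³_loc({t ≤ 0} × ℝ³)`.  This is the apex-class twin of
the tree theorem `recurrentReduction_proof` (`Theorems/RecurrentProfilesRecurrentReduction.lean`,
rate class `‖u‖ ≤ C/√(−t)`), and the proof is adapted from it verbatim:

* MODEL.  The `L³_loc` slab-field space `Literature.Analysis.FluidPDE.SlabField ℝ³ ℝ³ 3` (fields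
  lying in `L³(Q(0, R))` for every `R`, Fréchet topology of the seminorms `‖·‖_{L³(Q(0, n+1))}`,
  pseudo-metrisable) with its scaling flow `SlabField.flow σ w = w_{e^σ}` acting by continuous maps.
* ORBIT CLOSURE.  `S` = closure of the orbit of `u`; invariant and compact
  (`SlabField.isCompact_closure_orbit`): every sequence of orbit points subconverges
  (`exists_orbit_limit` — the tree's engine `slab_typeI_compactness`, Albritton–Barker 2019,
  Lemma 2.2 + Prop. 2.3, on the exhausting balls; it is fed with the RATE `C/√(−t)`, a consequence
  of the apex bound).
* BIRKHOFF.  `S` carries a uniformly recurrent point `a` (Furstenberg 1981, Thm. 1.16), whose field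
  is uniformly recurrent under scaling (dictionary `SlabField.isUniformlyRecurrentPt_iff`; packaged
  as `SlabField.exists_isScalingUniformlyRecurrent_mem_closure_orbit`).
* THE APEX BOUND SURVIVES.  It is scale invariant (`HasTypeIDecay.nsRescale`), so every orbit
  point carries it with the same `C`, and it is closed under `L³_loc` limits almost everywhere
  (`satDR_ae_apex_of_tendsto_eLpNorm`: on each ball a subsequence converges a.e.).
* IDENTIFICATION.  `a` is an `X`-limit of orbit points, hence a.e. equal on the slab (uniqueness
  of `L³_loc` limits) to an engine limit: a suitable weak solution with a weak gradient,
  `𝐈 ≤ 4 𝐈(u) < ∞`, singular at the origin (persistence of singularities), with the apex bound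
  a.e.; recurrence does not see null sets of the slab (`IsScalingUniformlyRecurrent.congr_ae`) and
  `exists_apex_profile_repr` makes the apex bound pointwise.

## References

* H. Furstenberg, *Recurrence in Ergodic Theory and Combinatorial Number Theory*, Princeton UP
  (1981), Ch. 1 §4, Thm. 1.16. [Furstenberg1981]
* D. Albritton, T. Barker, J. Math. Fluid Mech. 21 (2019), no. 43 = arXiv:1811.00502, Lemma 2.2,
  Prop. 2.3, §3. [AlbrittonBarker2019]
* G. Koch, N. Nadirashvili, G. Seregin, V. Šverák, Acta Math. 203 (2009), (1.6). [KNSS2009]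
-/

noncomputable section

-- the sub-problem namespace repeats the summit name (D-0017 layout `Summit.<S>.<P>.Theorems`)
set_option linter.dupNamespace false

namespace Summit.NavierStokesRegularity.NavierStokesRegularity.Theorems

open MeasureTheory Set Function Filter Topology TopologicalSpace Metric
open Literature.Analysis.FluidPDE
open scoped NNReal ENNReal

/-! ### The apex bound passes to `L³_loc` limits -/

/-- **The apex bound passes to `L³_loc` limits, almost everywhere on the slab.**  If every `v_j`
obeys `‖v_j(s, y)‖ ≤ C/(‖y‖ + √(−s))` (`s < 0`) and `v_j → w` in `L³(Q(0, n+1))` for every `n`,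
then `‖w(s, y)‖ ≤ C/(‖y‖ + √(−s))` for a.e. `(s, y) ∈ ℝ₋ × ℝ³`: on each ball a subsequence
converges a.e. (convergence in measure) and the pointwise bound is closed.
[cite: KNSS2009, (1.6)] -/
theorem satDR_ae_apex_of_tendsto_eLpNorm
    {v : ℕ → ℝ → EuclideanSpace ℝ (Fin 3) → EuclideanSpace ℝ (Fin 3)}
    {w : ℝ → EuclideanSpace ℝ (Fin 3) → EuclideanSpace ℝ (Fin 3)} {C : ℝ}
    (hapex : ∀ j, HasTypeIDecay C (v j))
    (hvm : ∀ (n : ℕ) (j : ℕ), AEStronglyMeasurable (uncurry (v j))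
      (volume.restrict (parabolicCylinder ((n : ℝ) + 1) (0 : ℝ × EuclideanSpace ℝ (Fin 3)))))
    (hwm : ∀ n : ℕ, AEStronglyMeasurable (uncurry w)
      (volume.restrict (parabolicCylinder ((n : ℝ) + 1) (0 : ℝ × EuclideanSpace ℝ (Fin 3)))))
    (hconv : ∀ n : ℕ, Tendsto (fun j => eLpNorm (uncurry (v j) - uncurry w) 3
      (volume.restrict (parabolicCylinder ((n : ℝ) + 1) (0 : ℝ × EuclideanSpace ℝ (Fin 3)))))
      atTop (𝓝 0)) :
    ∀ᵐ z ∂(volume.restrict (Iio (0 : ℝ) ×ˢ (univ : Set (EuclideanSpace ℝ (Fin 3))))),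
      ‖w z.1 z.2‖ ≤ C / (‖z.2‖ + Real.sqrt (-z.1)) := by
  -- adapted from RecurrentProfilesRecurrentReductionOrbit.lean (`ae_rate_of_tendsto_eLpNorm`)
  refine ae_restrict_of_ae_restrict_of_subset lowerHalf_subset_iUnion_parabolicCylinder ?_
  rw [ae_restrict_iUnion_iff]
  intro n
  have hTIM : TendstoInMeasure
      (volume.restrict (parabolicCylinder ((n : ℝ) + 1) (0 : ℝ × EuclideanSpace ℝ (Fin 3))))
      (fun j => uncurry (v j)) atTop (uncurry w) :=
    tendstoInMeasure_of_tendsto_eLpNorm (by norm_num) (hvm n) (hwm n) (hconv n)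
  obtain ⟨ns, -, hae⟩ := hTIM.exists_seq_tendsto_ae
  filter_upwards [hae, ae_restrict_mem (isOpen_parabolicCylinder _ _).measurableSet] with z hz hzQ
  refine le_of_tendsto hz.norm (Eventually.of_forall fun k => ?_)
  rw [SuitableCompactness.mem_parabolicCylinder_zero] at hzQ
  exact hapex (ns k) z.1 hzQ.1.2 z.2

/-! ### S3 — recurrence is not load-bearing in the apex class -/

/-- **S3, decayed recurrent reduction.**  If a suitable weak solution `(u, p)` of Navier–Stokes
(`ν = 1`, `f = 0`) on `ℝ³ × ℝ₋` with weak gradient `G`, `𝐈(ℝ³ × ℝ₋) < ∞` and the apex bound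
`‖u(t,x)‖ ≤ C/(‖x‖ + √(−t))` is singular at the origin, then some member of the same class — SAME
apex constant `C` — is singular at the origin AND uniformly recurrent under the scaling
`σ ↦ u_{e^σ}` in `L³_loc` of `{t ≤ 0} × ℝ³`.
Proof (Birkhoff–Furstenberg on the orbit closure, as in `recurrentReduction_proof`).  MODEL: the
`L³_loc` slab-field space `SlabField ℝ³ ℝ³ 3` (Fréchet topology of the seminorms `L³(Q(0, n+1))`,
pseudo-metrisable) with its scaling flow `SlabField.flow` acting by continuous maps.  ORBIT
CLOSURE: `S` = closure of the orbit of `u`; invariant and compact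
(`SlabField.isCompact_closure_orbit`: `exists_orbit_limit` = A–B Lemma 2.2 on exhausting balls, fed
with the rate `C/√(−t)` implied by the apex bound).  BIRKHOFF: `S` carries a uniformly recurrent
point `a` (Furstenberg 1981 Thm 1.16), whose field is uniformly recurrent under scaling
(`SlabField.exists_isScalingUniformlyRecurrent_mem_closure_orbit`).  APEX BOUND: scale
invariant (`HasTypeIDecay.nsRescale`) and closed under a.e. limits
(`satDR_ae_apex_of_tendsto_eLpNorm`), so engine limits of orbit sequences carry it a.e.
IDENTIFICATION: `a` is a.e. equal on the slab (uniqueness of `L³_loc` limits) to an engine limit —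
suitable, `𝐈 ≤ 4 𝐈(u)`, singular at the origin by persistence of singularities (A–B Prop. 2.3),
apex bound a.e.; recurrence does not see null sets (`IsScalingUniformlyRecurrent.congr_ae`) and
`exists_apex_profile_repr` makes the apex bound pointwise.
[cite: Furstenberg1981, Ch. 1 §4 Thm. 1.16] [cite: AlbrittonBarker2019, Lemma 2.2, Prop. 2.3]
[cite: KNSS2009, (1.6)] -/
theorem stub_satDecayedReduction :
    ∀ (u : ℝ → EuclideanSpace ℝ (Fin 3) → EuclideanSpace ℝ (Fin 3))
      (p : ℝ → EuclideanSpace ℝ (Fin 3) → ℝ)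
      (G : ℝ → EuclideanSpace ℝ (Fin 3) → EuclideanSpace ℝ (Fin 3) →L[ℝ] EuclideanSpace ℝ (Fin 3)) (C : ℝ),
      IsSuitableWeakSolutionOn (slab (EuclideanSpace ℝ (Fin 3)) (Iio 0) isOpen_Iio) 1 0 u p →
      HasWeakSpatialGradientOn (slab (EuclideanSpace ℝ (Fin 3)) (Iio 0) isOpen_Iio) u G →
      typeIBound (Iio (0 : ℝ) ×ˢ univ) u p G < ⊤ → HasTypeIDecay C u →
      IsBackwardSingularPoint u 0 →
      ∃ (w : ℝ → EuclideanSpace ℝ (Fin 3) → EuclideanSpace ℝ (Fin 3))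
        (q : ℝ → EuclideanSpace ℝ (Fin 3) → ℝ)
        (H : ℝ → EuclideanSpace ℝ (Fin 3) → EuclideanSpace ℝ (Fin 3) →L[ℝ] EuclideanSpace ℝ (Fin 3)),
        IsSuitableWeakSolutionOn (slab (EuclideanSpace ℝ (Fin 3)) (Iio 0) isOpen_Iio) 1 0 w q ∧
        HasWeakSpatialGradientOn (slab (EuclideanSpace ℝ (Fin 3)) (Iio 0) isOpen_Iio) w H ∧
        typeIBound (Iio (0 : ℝ) ×ˢ univ) w q H < ⊤ ∧ HasTypeIDecay C w ∧
        IsBackwardSingularPoint w 0 ∧ IsScalingUniformlyRecurrent w := by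
  -- adapted from RecurrentProfilesRecurrentReduction.lean (`recurrentReduction_proof`)
  intro u p G C hsw hwg hI hdec hsing
  classical
  haveI h13 : Fact (1 ≤ (3 : ℝ≥0∞)) := ⟨by norm_num⟩
  -- `0 ≤ C`, and the rate `C/√(−t)` implied by the apex bound (feeds the engine)
  have hC0 : 0 ≤ C := by
    have h := hdec (-1) (by norm_num) 0
    have h1 : (0 : ℝ) ≤ C / (‖(0 : EuclideanSpace ℝ (Fin 3))‖ + Real.sqrt (-(-1 : ℝ))) :=
      (norm_nonneg _).trans h
    rw [norm_zero, zero_add, neg_neg, Real.sqrt_one, div_one] at h1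
    exact h1
  have hdecT : HasTypeITimeDecay C u := hdec.hasTypeITimeDecay hC0
  -- ## the model: `u` as a point of the `L³_loc` slab-field space `SlabField ℝ³ ℝ³ 3`
  let x₀ : SlabField (EuclideanSpace ℝ (Fin 3)) (EuclideanSpace ℝ (Fin 3)) 3 :=
    SlabField.ofMemLp u fun R hR => memLp_three_of_slabProfile hwg hI hR
  -- ## KEY: subsequential limits of orbit sequences (the engine), with the apex bound a.e.
  have hkey : ∀ σs : ℕ → ℝ,
      ∃ (a : SlabField (EuclideanSpace ℝ (Fin 3)) (EuclideanSpace ℝ (Fin 3)) 3) (ψ : ℕ → ℕ),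
      StrictMono ψ ∧ Tendsto (fun j => SlabField.flow (σs (ψ j)) x₀) atTop (𝓝 a) ∧
      ∃ (q : ℝ → EuclideanSpace ℝ (Fin 3) → ℝ)
        (H : ℝ → EuclideanSpace ℝ (Fin 3) → EuclideanSpace ℝ (Fin 3) →L[ℝ] EuclideanSpace ℝ (Fin 3)),
        IsSuitableWeakSolutionOn (slab (EuclideanSpace ℝ (Fin 3)) (Iio 0) isOpen_Iio) 1 0 a.toFun q ∧
        HasWeakSpatialGradientOn (slab (EuclideanSpace ℝ (Fin 3)) (Iio 0) isOpen_Iio) a.toFun H ∧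
        typeIBound (Iio (0 : ℝ) ×ˢ univ) a.toFun q H < ⊤ ∧ IsBackwardSingularPoint a.toFun 0 ∧
        (∀ᵐ z ∂(volume.restrict (Iio (0 : ℝ) ×ˢ (univ : Set (EuclideanSpace ℝ (Fin 3))))),
          ‖a.toFun z.1 z.2‖ ≤ C / (‖z.2‖ + Real.sqrt (-z.1))) := by
    intro σs
    obtain ⟨u', p', H', ψ, hψ, hsw', hwg', hI', hsing', -, hconv'⟩ :=
      exists_orbit_limit hsw hwg hI hsing hdecT (fun k => Real.exp (σs k)) (fun k => Real.exp_pos _)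
    have hI'' : typeIBound (Iio (0 : ℝ) ×ˢ univ) u' p' H' < ⊤ :=
      lt_of_le_of_lt hI' (ENNReal.mul_lt_top (by simp) hI)
    let a : SlabField (EuclideanSpace ℝ (Fin 3)) (EuclideanSpace ℝ (Fin 3)) 3 :=
      SlabField.ofMemLp u' fun R hR => memLp_three_of_slabProfile hwg' hI'' hR
    -- the apex bound is scale invariant and closed under a.e. limits
    have hapex' : ∀ᵐ z ∂(volume.restrict (Iio (0 : ℝ) ×ˢ (univ : Set (EuclideanSpace ℝ (Fin 3))))),
        ‖u' z.1 z.2‖ ≤ C / (‖z.2‖ + Real.sqrt (-z.1)) :=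
      satDR_ae_apex_of_tendsto_eLpNorm (v := fun j => nsRescale (Real.exp (σs (ψ j))) u)
        (fun j => hdec.nsRescale (Real.exp_pos _))
        (fun n j => ((SlabField.flow (σs (ψ j)) x₀).memLp ((n : ℝ) + 1)).1)
        (fun n => (a.memLp ((n : ℝ) + 1)).1) (fun n => hconv' _ (by positivity))
    refine ⟨a, ψ, hψ, ?_, p', H', hsw', hwg', hI'', hsing', hapex'⟩
    rw [SlabField.tendsto_flow_iff_forall]
    exact hconv'
  -- ## compactness of the orbit closure (Albritton–Barker compactness fed to the model)
  have hScpt : IsCompact (closure (range fun σ => SlabField.flow σ x₀)) :=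
    x₀.isCompact_closure_orbit fun σs => by
      obtain ⟨a, ψ, hψ, ha, -⟩ := hkey σs
      exact ⟨a, ψ, hψ, ha⟩
  -- ## Birkhoff + dictionary: a profile of the hull uniformly recurrent under scaling
  obtain ⟨a, haS, hrecF⟩ := x₀.exists_isScalingUniformlyRecurrent_mem_closure_orbit hScpt
  -- ## identification of `a` with an engine limit, up to a null set of the slab
  obtain ⟨xs, hxs, hxa⟩ := mem_closure_iff_seq_limit.1 haS
  choose σs hσs using hxs
  obtain ⟨b, ψ, hψ, hb, q, H, hswb, hwgb, hIb, hsingb, hapexb⟩ := hkey σs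
  have hxa' : Tendsto (fun j => SlabField.flow (σs (ψ j)) x₀) atTop (𝓝 a) :=
    (hxa.comp hψ.tendsto_atTop).congr fun j => (hσs (ψ j)).symm
  have hrecb : IsScalingUniformlyRecurrent b.toFun :=
    hrecF.congr_ae (SlabField.ae_eq_of_tendsto hxa' hb)
  -- ## the pointwise apex bound: modification on a null set of the slab
  obtain ⟨w, hbw, hsww, hwgw, hIw, hdecw, hsingw⟩ :=
    exists_apex_profile_repr hC0 hswb hwgb hIb hsingb hapexb
  exact ⟨w, q, H, hsww, hwgw, hIw, hdecw, hsingw, hrecb.congr_ae hbw⟩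

end Summit.NavierStokesRegularity.NavierStokesRegularity.Theorems

end
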